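import Summits.Ventures.CertifiedQuantumChemistry.Certificates.HubbardRingL4SingletDualFamily
import HarnessLib

/-!
# Ventures/CertifiedQuantumChemistry — Certificates/HubbardRingL4SingletDualCheck4.lean: the order-`4` coefficient identity of the
# explicit finite-`U` dual certificate family for the `(2,2)`-sector `DQG + ⟨Ŝ²⟩ = 0` programme of the Hubbard 4-ring (one kernel `decide`)

HONEST FRAMING (verbatim): certified bounds for a stated model Hamiltonian in a stated basis; not a claim about the real molecule beyond that model. A kernel identity for an AUXILIARY dual object; no model value, no row, no claim node.

Seat rdm-B (gen 44). `(dualAt 4).check = true`: the canonical `Γ`-, `γ`- and constant defects of the order-`4` record vanish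
(`DualL4.Dual.check`, `Certificates/HubbardRingL4SectorDual.lean`), i.e. the coefficient of `ε^4` of the Lagrangian identity
`Σ doublons − 2ε·Σ bonds − mu(ε) = Σ_j ⟨Z_j(ε), B_j(γ, Γ)⟩ + Σ_rows mult(ε)·row` holds on every Hermitian, pair-antisymmetric,
`S_z`-diagonal `(γ, Γ)`. Offline the same identity was checked in exact arithmetic twice (`tools/x14-g44/dual4/exactify.py`,
`indepcheck.py`). 0 sorry, 0 def; standard axioms.
-/

namespace Summit.Ventures.CertifiedQuantumChemistry

namespace DualL4.Singlet

/-- **Order `4` passes the check** (kernel evaluation on the literal tables). -/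
theorem check4 : (dualAt 4).check = true := by
  decide +kernel

end DualL4.Singlet

end Summit.Ventures.CertifiedQuantumChemistry
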